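import Literature.Computability.MetaComplexity.HeuristicClassesReductionProofs
import HarnessLib

/-!
# Heuristic polynomial-time reducibility is transitive (Bogdanov–Trevisan 2006, §3.1) — the proof

Computability/MetaComplexity support file (theorem-only) containing the discharge
`Literature.Computability.MetaComplexity.DistProblem.PolyTimeReducible.trans_holds` of the named
fact `Literature.Computability.MetaComplexity.DistProblem.PolyTimeReducible.trans`
(`MetaComplexity/HeuristicClasses`): if `(L₁, D₁) ≤_{AvgP} (L₂, D₂)` and `(L₂, D₂) ≤_{AvgP} (L₃, D₃)`
then `(L₁, D₁) ≤_{AvgP} (L₃, D₃)` (Bogdanov–Trevisan, remark after Def. 3.1).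

The proof is the one recorded with the fact: compose the maps as `x ↦ f₂(f₁(x; n); m₁(n))`,
which is polynomial time because `m₁` is a polynomial — assembled, exactly as in the accepted
sibling `HeuristicClassesReductionProofs` (closure of `AvgP`), from the reductions as total `FP`
string functions (`mem_FP_of_unaryArg`), the pair bricks `fanoutFn` / `Brick.sndF`, the unary pad
`Plumb.polyFn m₁` (`1ⁿ ↦ 1^{m₁(n)}`) and `PolyTimeComputable.of_encode`; the parameter map is
`m₂ ∘ m₁` (`Polynomial.comp`) and the domination factor `p₁ · (p₂ ∘ m₁)`, by pushing the
domination bound of `f₁` through the fibres of `f₂`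
(`toOuterMeasure_setOf_apply_mem_le_of_dominated`); correctness on `supp D₁,ₙ` transfers because
domination sends `supp D₁,ₙ` into `supp D₂,ₘ₁₍ₙ₎` (`apply_mem_support_of_dominated`).

This is NOT one of the Karp/promise transitivity facts sharing the short name `trans`
(`PolyTimeReducible.trans_holds` of `Complexity/PromiseProofs`, …): the declaration discharged
here is the distributional one, with parameter maps and domination.

No new definition, no new named fact.

## References

* A. Bogdanov, L. Trevisan, *Average-case complexity*, Found. Trends Theor. Comput. Sci. 2
  (2006), no. 1, §3.1 (Def. 3.1 and the remark after it; ECCC TR06-073, Def. 23).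
  [BogdanovTrevisan2006]
-/

namespace Literature.Computability.MetaComplexity

open _root_.Computability Complexity Polynomial
open scoped ENNReal

/-- The composite reduction `x ↦ f₂(f₁(x; n); m₁(n))` is polynomial time from `⟨x, 1ⁿ⟩`: on
`w = ⟨x, 1ⁿ⟩` the total `FP` function `F₂ ⟨F₁ w, 1^{m₁(|snd w|)}⟩` (reductions as total functions
via `mem_FP_of_unaryArg`, `fanoutFn`, `Brick.sndF`, `Plumb.polyFn`) outputs `f₂(f₁(x; n); m₁(n))`,
so the same machine computes the composite (`PolyTimeComputable.of_encode`).
[cite: BogdanovTrevisan2006, §3.1 (remark after Def. 3.1] -/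
theorem polyTimeComputable_paramEnc_comp {f₁ f₂ : List Bool → ℕ → List Bool}
    (hf₁ : PolyTimeComputable paramEnc (id : List Bool → List Bool) (Function.uncurry f₁))
    (hf₂ : PolyTimeComputable paramEnc (id : List Bool → List Bool) (Function.uncurry f₂))
    (m₁ : Polynomial ℕ) :
    PolyTimeComputable paramEnc (id : List Bool → List Bool)
      (Function.uncurry fun x n => f₂ (f₁ x n) (m₁.eval n)) := by
  -- the two reductions as total `FP` string functions `w ↦ fᵢ (boolUnpair w).1 |(boolUnpair w).2|`
  have hF₁ : (fun w => f₁ (boolUnpair w).1 (boolUnpair w).2.length) ∈ FP := mem_FP_of_unaryArg hf₁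
  have hF₂ : (fun w => f₂ (boolUnpair w).1 (boolUnpair w).2.length) ∈ FP := mem_FP_of_unaryArg hf₂
  refine PolyTimeComputable.of_encode
    (F := (fun w => f₂ (boolUnpair w).1 (boolUnpair w).2.length) ∘
      fanoutFn (fun w => f₁ (boolUnpair w).1 (boolUnpair w).2.length)
        (Plumb.polyFn m₁ ∘ Brick.sndF))
    (comp_mem_FP hF₂
      (fanoutFn_mem_FP hF₁ (comp_mem_FP (Plumb.polyFn_mem_FP m₁) Brick.sndF_mem_FP)))
    paramEnc (fun _ => rfl) fun q => ?_
  obtain ⟨x, n⟩ := q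
  simp [paramEnc, Brick.sndF, ones, unaryEncodeNat_eq_replicate]

/-- Domination composes: if `D₁` is dominated by `D₂` along `f₁` (factor `p₁`, parameter map
`m₁`) and `D₂` by `D₃` along `f₂` (factor `p₂`, parameter map `m₂`), then `D₁` is dominated by
`D₃` along `x ↦ f₂(f₁(x; n); m₁(n))` with factor `p₁ · (p₂ ∘ m₁)` and parameter map `m₂ ∘ m₁`:
push the bound for `f₁` through the fibre `{z | f₂(z; m₁(n)) = y}`
(`toOuterMeasure_setOf_apply_mem_le_of_dominated`), then apply the bound for `f₂`.
[cite: BogdanovTrevisan2006, §3.1 (remark after Def. 3.1] -/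
theorem IsDominatedVia.comp {D₁ D₂ D₃ : Ensemble} {f₁ f₂ : List Bool → ℕ → List Bool}
    {p₁ m₁ : Polynomial ℕ}
    (hd₁ : ∀ (n : ℕ) (y : List Bool),
      (D₁ n).toOuterMeasure {x | f₁ x n = y} ≤ ((p₁.eval n : ℕ) : ℝ≥0∞) * (D₂ (m₁.eval n)) y)
    (hd₂ : IsDominatedVia D₂ f₂ D₃) :
    IsDominatedVia D₁ (fun x n => f₂ (f₁ x n) (m₁.eval n)) D₃ := by
  obtain ⟨p₂, m₂, hd₂⟩ := hd₂
  refine ⟨p₁ * p₂.comp m₁, m₂.comp m₁, fun n y => ?_⟩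
  calc (D₁ n).toOuterMeasure {x | f₂ (f₁ x n) (m₁.eval n) = y}
      = (D₁ n).toOuterMeasure {x | f₁ x n ∈ {z | f₂ z (m₁.eval n) = y}} := rfl
    _ ≤ ((p₁.eval n : ℕ) : ℝ≥0∞) * (D₂ (m₁.eval n)).toOuterMeasure {z | f₂ z (m₁.eval n) = y} :=
      toOuterMeasure_setOf_apply_mem_le_of_dominated hd₁ n _
    _ ≤ ((p₁.eval n : ℕ) : ℝ≥0∞) *
        ((((p₂.eval (m₁.eval n)) : ℕ) : ℝ≥0∞) * (D₃ (m₂.eval (m₁.eval n))) y) :=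
      mul_le_mul_right (hd₂ (m₁.eval n) y) _
    _ = (((p₁ * p₂.comp m₁).eval n : ℕ) : ℝ≥0∞) * (D₃ ((m₂.comp m₁).eval n)) y := by
      rw [eval_mul, eval_comp, eval_comp, Nat.cast_mul, mul_assoc]

/-- **Discharge of `DistProblem.PolyTimeReducible.trans`**: heuristic polynomial-time
reductions compose — the map `x ↦ f₂(f₁(x; n); m₁(n))` (`polyTimeComputable_paramEnc_comp`),
correct on `supp D₁,ₙ` because domination sends it into `supp D₂,ₘ₁₍ₙ₎`
(`apply_mem_support_of_dominated`) where `f₂` is correct, with the composed domination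
`IsDominatedVia.comp`. [cite: BogdanovTrevisan2006, §3.1 (remark after Def. 3.1] -/
theorem DistProblem.PolyTimeReducible.trans_holds : DistProblem.PolyTimeReducible.trans := by
  rintro Q₁ Q₂ Q₃ ⟨f₁, hf₁, hc₁, p₁, m₁, hd₁⟩ ⟨f₂, hf₂, hc₂, hd₂⟩
  refine ⟨fun x n => f₂ (f₁ x n) (m₁.eval n), polyTimeComputable_paramEnc_comp hf₁ hf₂ m₁,
    fun n x hx => ?_, IsDominatedVia.comp hd₁ hd₂⟩
  have hx₂ : f₁ x n ∈ (Q₂.dist (m₁.eval n)).support := apply_mem_support_of_dominated hd₁ hx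
  exact (hc₂ (m₁.eval n) (f₁ x n) hx₂).trans (hc₁ n x hx)

/-- Usable form of `DistProblem.PolyTimeReducible.trans_holds`.
[cite: BogdanovTrevisan2006, §3.1 (remark after Def. 3.1] -/
theorem DistProblem.PolyTimeReducible.trans' {Q₁ Q₂ Q₃ : DistProblem}
    (h₁₂ : Q₁.PolyTimeReducible Q₂) (h₂₃ : Q₂.PolyTimeReducible Q₃) : Q₁.PolyTimeReducible Q₃ :=
  DistProblem.PolyTimeReducible.trans_holds h₁₂ h₂₃

/-- Hardness propagates along heuristic reductions: if `Q` is hard for `𝒞` and `Q ≤_{AvgP} Q'`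
then `Q'` is hard for `𝒞` (transitivity). [cite: BogdanovTrevisan2006, §3.1 (Def. 3.1  " DistNP -hard"] -/
theorem IsDistHard.of_polyTimeReducible {𝒞 : Set DistProblem} {Q Q' : DistProblem}
    (hQ : IsDistHard 𝒞 Q) (h : Q.PolyTimeReducible Q') : IsDistHard 𝒞 Q' :=
  fun Q₀ hQ₀ => DistProblem.PolyTimeReducible.trans' (hQ Q₀ hQ₀) h

end Literature.Computability.MetaComplexity
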